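import Literature.Computability.QuantumComplexity.MajorityQueryAlgorithmCore
import Literature.Computability.QuantumComplexity.ExactThresholdQueryComplexity
import HarnessLib

/-!
# `Q_E(MAJ_{2k+1}) = k + 1`: the exact `(k+1)`-query algorithm of Ambainis–Iraids–Smotrovs (2013), Thm. 2

Topic `Computability/QuantumComplexity`. A. Ambainis, J. Iraids, J. Smotrovs, *Exact quantum query
complexity of EXACT and THRESHOLD*, TQC 2013 [AmbainisIraidsSmotrovs2013], §4 (held text
`paper:arxiv-1302.1235`, p. 6 L1–45; the proof is quoted and mapped declaration by declaration in
`MajorityQueryAlgorithmCore.lean`):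

> **Theorem 2.** `Q_E(MAJ_{2k+1}) ≤ k + 1`. *Proof.* Again, a recursive solution […]. The base case `k = 0`
> is trivial to perform with one query, because the function returns the value of the single variable. […]

This file assembles the program in the tree's model `QQueryAlg (2k+1)` [BealsEtAl2001, §2] and proves
Theorem 2 as printed, together with the equality `Q_E(MAJ_{2k+1}) = k + 1` whose floor is [AIS13, Prop. 3]
(`max{k+1, (2k+1) − (k+1) + 1} ≤ Q_E`, typed as `ExactThreshold.le_quantumQueryComplexity_zero_threshold`):

* `G0` — the printed `U_1` of the first call (a Householder reflection `QProg.householder`, `c0`, `c0_eq_phiC`);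
* `roundGate r` — the printed `U_2` of the `r`-th call followed by the deferred measurement and the next
  call's `U_1`: `IsoGate.invoGateU (Dset k r) (wvec r) (wvec_isAdmissible r)`;
* `rotGate` — the base case: a fixed rotation `1 ⊗ T ⊗ 1` of the target with `T|−⟩ = |0⟩` (`rotT`,
  `rotGate_mulVec_phiC`), after which the last query writes the value of the last free variable into the
  target (`finalState_apply`, `final_term`);
* `majProg k = [G0, (O_x, U_0), …, (O_x, U_{k−1}), T, O_x]`, `numQueries_majProg : = k + 1`,
  `majAlg k : QQueryAlg (2k+1)` accepting `target = 1` (`acceptSet`);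
* the invariant `runTok_rounds`: after `n ≤ k` rounds the state IS `live x n = Σ_{g valid} β_n(g) · ψ_g ⊗ |−⟩`
  (nothing is parked: both outcome kinds recurse; one round = `roundGate_query_live`, from
  `roundGate_mulVec_psiX` and the re-indexing `sum_validSet_reindex`);
* exactness `majAlg_acceptProb : acceptProb = [ k + 1 ≤ |x| ]` — every surviving full history ends on a
  variable carrying the majority value (`eq_maj_of_beta_ne_zero`), the final state has unit mass
  (`QProg.sum_norm_sq_runTok`), so the accepted mass is `1` or `0`;
* **`quantumQueryComplexity_maj_le`** (`Q_ε([ k+1 ≤ |x| ]) ≤ k + 1` on `Fin (2k+1)`, `0 ≤ ε`; Thm. 2) and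
  **`quantumQueryComplexity_zero_maj`** (`Q_E([ k+1 ≤ |x| ]) = k + 1`; Thm. 2 with Prop. 3).

Everything is proved; no fact, instance, notation or axiom is introduced.

* [AmbainisIraidsSmotrovs2013] A. Ambainis, J. Iraids, J. Smotrovs, *Exact quantum query complexity of
  EXACT and THRESHOLD*, Proc. TQC 2013 (LIPIcs 22) 263–269; arXiv:1302.1235 — §4, Thm. 2 (p. 6 L10–45),
  Prop. 3 (p. 6 L55–62).
* [BealsEtAl2001] R. Beals, H. Buhrman, R. Cleve, M. Mosca, R. de Wolf, *Quantum lower bounds by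
  polynomials*, J. ACM 48(4) (2001) 778–797 — §2 (the query model, phase queries).
-/

noncomputable section

open Finset Matrix
open scoped Kronecker
open Literature.Computability.Cryptography
open Literature.Computability.QuantumComplexity.QProg
open Literature.Computability.QuantumComplexity.Grover (rhalf rhalfC_mul_rhalfC)
open Literature.Computability.QuantumComplexity.ExactHalf (sum_offDiag_eq_sum_erase)
open Literature.Computability.QuantumComplexity.ExactThreshold (le_quantumQueryComplexity_zero_threshold)

namespace Literature.Computability.QuantumComplexity.Majority

variable {k : ℕ}

/-! ### The target qubit in `|−⟩`, the prepared state, the final rotation -/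

/-- The amplitudes of `|−⟩ = (|0⟩ − |1⟩)/√2` on the target qubit. [cite: BealsEtAl2001, §2] -/
def tgt (b : Bool) : ℝ := if b = true then -rhalf else rhalf

/-- `|−⟩` is a unit vector. [cite: BealsEtAl2001, §2] -/
theorem tgt_sq_add : tgt true ^ 2 + tgt false ^ 2 = 1 := by
  have h := Grover.rhalf_mul_rhalf
  simp only [tgt, Bool.false_eq_true, if_false, if_true, sq]
  linarith

/-- The two-slice state `ψ_g ⊗ |−⟩ = Σ_b tgt b · ψ_{g,b}`. [cite: AmbainisIraidsSmotrovs2013, §4] -/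
def phiC (g : Hist k) : S k → ℂ := ∑ b : Bool, (tgt b : ℂ) • psiC g b

/-- Its phased form after a query. [cite: AmbainisIraidsSmotrovs2013, §4] -/
def phiX (x : Fin (2 * k + 1) → Bool) (g : Hist k) : S k → ℂ := ∑ b : Bool, (tgt b : ℂ) • psiX x g b

/-- **The query acts on `ψ_g ⊗ |−⟩` by the phases `x̂_l`.** [cite: BealsEtAl2001, §2] -/
theorem queryOracle_mulVec_phiC (x : Fin (2 * k + 1) → Bool) (g : Hist k) :
    queryOracle x *ᵥ phiC g = phiX x g := by
  funext s
  obtain ⟨l, b', ws⟩ := s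
  rw [queryOracle_mulVec_apply]
  simp only [phiC, phiX, Finset.sum_apply, Pi.smul_apply, smul_eq_mul, Fintype.sum_bool, psiX, psiC, psiR]
  by_cases hws : ws = g
  · cases b' <;> cases hx : x l <;> simp [tgt, xhat, hx, hws]
  · cases b' <;> cases hx : x l <;> simp [hws]

/-- The starting basis state `|0⟩|0⟩|∅⟩`. [cite: AmbainisIraidsSmotrovs2013, §4] -/
def startS (k : ℕ) : S k := (⟨0, by omega⟩, false, emptyHist k)

/-- The real amplitudes of the prepared state `(1/√(2k+1)) Σ_i |i⟩ ⊗ |−⟩ ⊗ |∅⟩`.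
[cite: AmbainisIraidsSmotrovs2013, §4 (`U_1|0⟩ → Σ (1/√(2m+1)) |i⟩`)] -/
def c0 (s : S k) : ℝ := tgt s.2.1 * psiR (emptyHist k) s.2.1 s

/-- Slices, two-dimensional form. [folklore] -/
private theorem sum_slice₂ {M : Type*} [AddCommMonoid M] (ws : WS k) (G : Fin (2 * k + 1) → Bool → M) :
    ∑ s : S k, (if s.2.2 = ws then G s.1 s.2.1 else 0) = ∑ l, ∑ b, G l b := by
  rw [Fintype.sum_prod_type]
  refine Finset.sum_congr rfl fun l _ => ?_
  rw [Fintype.sum_prod_type]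
  refine Finset.sum_congr rfl fun b _ => ?_
  rw [Finset.sum_ite_eq' univ ws]
  simp

/-- The prepared amplitudes form a unit vector. [cite: AmbainisIraidsSmotrovs2013, §4] -/
theorem sum_c0_sq : ∑ s : S k, c0 s ^ 2 = 1 := by
  have : ∀ s : S k, c0 s ^ 2 = if s.2.2 = emptyHist k then
      tgt s.2.1 ^ 2 * campl (emptyHist k) s.1 ^ 2 else 0 := fun s => by
    unfold c0 psiR
    by_cases h : s.2.2 = emptyHist k
    · rw [if_pos ⟨rfl, h⟩, if_pos h]; ring
    · rw [if_neg (fun hh => h hh.2), if_neg h]; ring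
  simp_rw [this]
  rw [sum_slice₂ (emptyHist k) (fun l b => tgt b ^ 2 * campl (emptyHist k) l ^ 2)]
  simp_rw [Fintype.sum_bool, ← add_mul, tgt_sq_add, one_mul]
  exact sum_campl_sq (free_nonempty valid_emptyHist (Nat.zero_le k))

/-- The preparation gate `G₀` (the printed `U_1` of the first call): a Householder reflection taking the start
state to the prepared state. [cite: AmbainisIraidsSmotrovs2013, §4] -/
def G0 (k : ℕ) : Matrix.unitaryGroup (S k) ℂ :=
  ⟨householder c0 (startS k), householder_mem_unitaryGroup _ _⟩

/-- `G₀ |start⟩ =` the prepared state. [cite: AmbainisIraidsSmotrovs2013, §4] -/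
theorem G0_mulVec_start :
    (G0 k : Matrix (S k) (S k) ℂ) *ᵥ Pi.single (startS k) 1 = fun s => (c0 s : ℂ) :=
  householder_mulVec_single sum_c0_sq _

/-- The prepared state is `ψ_∅ ⊗ |−⟩`. [cite: AmbainisIraidsSmotrovs2013, §4] -/
theorem c0_eq_phiC : (fun s => (c0 s : ℂ)) = phiC (emptyHist k) := by
  funext s
  simp only [phiC, c0, Finset.sum_apply, Pi.smul_apply, smul_eq_mul, Fintype.sum_bool, psiC]
  push_cast
  obtain ⟨l, b, ws⟩ := s
  cases b
  · simp [psiR]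
  · simp [psiR]

/-- The `2 × 2` rotation `T` on the target with `T|−⟩ = |0⟩` (rows `(r, −r)`, `(r, r)`, `r = 1/√2`).
[cite: AmbainisIraidsSmotrovs2013, §4 (base case: "the function returns the value of the single variable")] -/
def rotT : Matrix Bool Bool ℂ := Matrix.of fun b c => if b = true then (rhalf : ℂ) else (if c = true then -(rhalf : ℂ) else rhalf)

/-- `T` is unitary. [cite: AmbainisIraidsSmotrovs2013, §4] -/
theorem rotT_mem_unitaryGroup : rotT ∈ Matrix.unitaryGroup Bool ℂ := by
  rw [Matrix.mem_unitaryGroup_iff]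
  ext b b'
  simp only [Matrix.mul_apply, Matrix.star_apply, rotT, Matrix.of_apply, one_apply, Fintype.sum_bool]
  have h := rhalfC_mul_rhalfC
  have hs : star (rhalf : ℂ) = rhalf := Complex.conj_ofReal _
  cases b <;> cases b' <;> simp [hs] <;> linear_combination (2 : ℂ) * h

/-- `T |−⟩ = |0⟩`: `Σ_c T b c · tgt c = [b = 0]`. [cite: AmbainisIraidsSmotrovs2013, §4] -/
theorem rotT_tgt (b : Bool) : ∑ c : Bool, rotT b c * (tgt c : ℂ) = if b = true then 0 else 1 := by
  have h := rhalfC_mul_rhalfC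
  simp only [Fintype.sum_bool, rotT, Matrix.of_apply, tgt, if_true, Bool.false_eq_true, if_false]
  push_cast
  cases b
  · simp only [Bool.false_eq_true, if_false]; linear_combination (2 : ℂ) * h
  · simp only [if_true]; ring

/-- The final rotation gate `1 ⊗ T ⊗ 1` on `Fin (2k+1) × Bool × WS k`. [cite: AmbainisIraidsSmotrovs2013, §4] -/
def rotGate (k : ℕ) : Matrix.unitaryGroup (S k) ℂ :=
  ⟨(1 : Matrix (Fin (2 * k + 1)) (Fin (2 * k + 1)) ℂ) ⊗ₖ (rotT ⊗ₖ (1 : Matrix (WS k) (WS k) ℂ)),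
    Matrix.kronecker_mem_unitary (Submonoid.one_mem _)
      (Matrix.kronecker_mem_unitary rotT_mem_unitaryGroup (Submonoid.one_mem _))⟩

/-- The rotation acts on the target index only. [cite: AmbainisIraidsSmotrovs2013, §4] -/
theorem rotGate_mulVec_apply (v : S k → ℂ) (s : S k) :
    ((rotGate k : Matrix (S k) (S k) ℂ) *ᵥ v) s = ∑ c : Bool, rotT s.2.1 c * v (s.1, c, s.2.2) := by
  obtain ⟨l, b, w⟩ := s
  rw [rotGate]
  simp only [mulVec, dotProduct, Fintype.sum_prod_type]
  rw [Finset.sum_eq_single l]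
  · refine Finset.sum_congr rfl fun c _ => ?_
    rw [Finset.sum_eq_single w]
    · simp
    · intro w' _ hw'
      simp [Ne.symm hw']
    · intro h; exact absurd (Finset.mem_univ _) h
  · intro l' _ hl'
    refine Finset.sum_eq_zero fun c _ => Finset.sum_eq_zero fun w' _ => ?_
    simp [Matrix.one_apply, Ne.symm hl']
  · intro h; exact absurd (Finset.mem_univ _) h

/-- **The rotation sends `ψ_g ⊗ |−⟩` to `ψ_g ⊗ |0⟩`.** [cite: AmbainisIraidsSmotrovs2013, §4] -/
theorem rotGate_mulVec_phiC (g : Hist k) :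
    (rotGate k : Matrix (S k) (S k) ℂ) *ᵥ phiC g = psiC g false := by
  funext s
  rw [rotGate_mulVec_apply]
  simp only [phiC, Finset.sum_apply, Pi.smul_apply, smul_eq_mul, psiC, psiR]
  obtain ⟨l, b, w⟩ := s
  simp only
  by_cases hw : w = g
  · subst hw
    have : ∀ c : Bool, rotT b c * ∑ b' : Bool, (tgt b' : ℂ) * ((if c = b' ∧ w = w then campl w l else 0 : ℝ) : ℂ)
        = rotT b c * (tgt c : ℂ) * campl w l := fun c => by
      rw [Fintype.sum_bool]
      cases c <;> simp <;> ring
    rw [Finset.sum_congr rfl fun c _ => this c, ← Finset.sum_mul, rotT_tgt]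
    cases b <;> simp
  · have : ∀ c b' : Bool, ((if c = b' ∧ w = g then campl g l else 0 : ℝ) : ℂ) = 0 := fun c b' => by
      rw [if_neg (fun hh => hw hh.2)]; simp
    simp [hw]

/-! ### The round gates and the program -/

/-- The round gate `U_r` (the printed `U_2` of the `r`-th call + deferred measurement + next `U_1`), as a unitary.
[cite: AmbainisIraidsSmotrovs2013, §4 (proof of Thm. 2)] -/
def roundGate (r : Fin k) : Matrix.unitaryGroup (S k) ℂ :=
  IsoGate.invoGateU (Dset k r) (wvec r) (wvec_isAdmissible r)

/-- The round gate by a natural index (identity past `k`). [folklore] -/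
def roundGateN (k : ℕ) (n : ℕ) : Matrix.unitaryGroup (S k) ℂ :=
  if h : n < k then roundGate ⟨n, h⟩ else 1

/-- The first `n` rounds: `(query, U_0), …, (query, U_{n−1})`. [cite: AmbainisIraidsSmotrovs2013, §4] -/
def rounds (k : ℕ) : ℕ → List (QTok (2 * k + 1) (WS k))
  | 0 => []
  | n + 1 => rounds k n ++ [QTok.query, QTok.gate (roundGateN k n)]

/-- **The program**: prepare, `k` rounds, rotate the target to `|0⟩`, one classical query; `k + 1` queries.
[cite: AmbainisIraidsSmotrovs2013, Thm. 2] -/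
def majProg (k : ℕ) : List (QTok (2 * k + 1) (WS k)) :=
  QTok.gate (G0 k) :: (rounds k k ++ [QTok.gate (rotGate k), QTok.query])

/-- `n` rounds make `n` queries. [cite: AmbainisIraidsSmotrovs2013, §4] -/
theorem numQueries_rounds : ∀ n, numQueries (rounds k n) = n
  | 0 => rfl
  | n + 1 => by rw [rounds, numQueries_append, numQueries_rounds n]; rfl

/-- **`k + 1` queries.** [cite: AmbainisIraidsSmotrovs2013, Thm. 2] -/
theorem numQueries_majProg : numQueries (majProg k) = k + 1 := by
  rw [majProg, numQueries, numQueries_append, numQueries_rounds]; rfl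

/-- Accept iff the target reads `1` (the value of the last variable). [cite: AmbainisIraidsSmotrovs2013, §4] -/
def acceptSet (k : ℕ) : Set (S k) := {s | s.2.1 = true}

/-- The algorithm in the model `QQueryAlg (2k+1)`. [cite: AmbainisIraidsSmotrovs2013, Thm. 2] -/
def majAlg (k : ℕ) : QQueryAlg (2 * k + 1) := toAlg (majProg k) (startS k) (acceptSet k)

/-- The algorithm makes `k + 1` queries. [cite: AmbainisIraidsSmotrovs2013, Thm. 2] -/
theorem majAlg_queries : (majAlg k).queries = k + 1 := by
  rw [majAlg, toAlg_queries, numQueries_majProg]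

/-! ### The state after `n` rounds -/

/-- The state after `n` rounds: `Σ_{g valid} β(g) · ψ_g ⊗ |−⟩` (every branch recurses; nothing is parked).
[cite: AmbainisIraidsSmotrovs2013, §4] -/
def live (x : Fin (2 * k + 1) → Bool) (n : ℕ) : S k → ℂ := ∑ g ∈ validSet k n, beta x n g • phiC g

/-- Before the first round the state is the prepared state (the only valid `0`-history is the empty one).
[cite: AmbainisIraidsSmotrovs2013, §4] -/
theorem live_zero (x : Fin (2 * k + 1) → Bool) : live x 0 = phiC (emptyHist k) := by
  have hV : validSet k 0 = {emptyHist k} := by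
    ext g
    rw [mem_validSet, Finset.mem_singleton]
    constructor
    · intro hv
      funext l
      cases hl : g l with
      | none => rfl
      | some p => obtain ⟨r, b⟩ := p; exact absurd (hv.1 l r b hl) (Nat.not_lt_zero _)
    · rintro rfl; exact valid_emptyHist
  rw [live, hV, Finset.sum_singleton, beta, one_smul]

/-- The amplitude recursion at a round index. [cite: AmbainisIraidsSmotrovs2013, §4] -/
theorem beta_succ (x : Fin (2 * k + 1) → Bool) (r : Fin k) (g : Hist k) :
    beta x (r.val + 1) g = beta x r.val (eraseRound g r) * (cN (k - r.val) : ℂ) * roundAmp x g r := by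
  rw [beta, dif_pos r.isLt]

/-! ### One round -/

/-- **The round gate on a phased slice state**: the pair children and the single children.
[cite: AmbainisIraidsSmotrovs2013, §4 (proof of Thm. 2, "The resulting state is …")] -/
theorem roundGate_mulVec_psiX (x : Fin (2 * k + 1) → Bool) (r : Fin k) {g : Hist k} (hv : Valid r.val g) (b : Bool) :
    (roundGate r : Matrix (S k) (S k) ℂ) *ᵥ psiX x g b =
      (cw g : ℂ) • ((aP (k - r.val) : ℂ) • ∑ q ∈ (free g).offDiag,
          (xhat x q.1 * pairSign q.1 q.2) • psiC (addTwo g r q.1 false q.2) b +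
        (aS (k - r.val) : ℂ) • ∑ q ∈ (free g).offDiag,
          (∑ l ∈ (free g).erase q.1, xhat x l) • psiC (addTwo g r q.1 true q.2) b) := by
  rw [psiX_eq_sum, mulVec_sum]
  have hcol : ∀ l ∈ free g, (roundGate r : Matrix (S k) (S k) ℂ) *ᵥ
      ((xhat x l * (cw g : ℂ)) • (Pi.single (l, b, g) (1 : ℂ) : S k → ℂ)) =
      (cw g : ℂ) • ((aP (k - r.val) : ℂ) • ∑ j ∈ (free g).erase l,
          (xhat x l * pairSign l j) • psiC (addTwo g r l false j) b +
        (aS (k - r.val) : ℂ) • ∑ j ∈ (free g).erase l, ∑ p ∈ (free g).erase j,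
          xhat x l • psiC (addTwo g r j true p) b) := by
    intro l hl
    rw [mulVec_smul, roundGate, IsoGate.invoGateU_val,
      IsoGate.invoGate_mulVec_single (wvec_isAdmissible r) (mem_Dset.2 ⟨hv, mem_free.1 hl⟩), wvec_eq]
    simp only [smul_add, Finset.smul_sum, smul_smul]
    congr 1
    · refine Finset.sum_congr rfl fun j _ => ?_
      congr 1; ring
    · refine Finset.sum_congr rfl fun j _ => Finset.sum_congr rfl fun p _ => ?_
      congr 1; ring
  rw [Finset.sum_congr rfl hcol, ← Finset.smul_sum, Finset.sum_add_distrib, ← Finset.smul_sum,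
    ← Finset.smul_sum]
  congr 1; congr 1
  · congr 1
    rw [sum_offDiag_eq_sum_erase]
  · congr 1
    have h1 : ∑ l ∈ free g, ∑ j ∈ (free g).erase l, ∑ p ∈ (free g).erase j, xhat x l • psiC (addTwo g r j true p) b =
        ∑ q ∈ (free g).offDiag, ∑ p ∈ (free g).erase q.2, xhat x q.1 • psiC (addTwo g r q.2 true p) b :=
      (sum_offDiag_eq_sum_erase (free g)
        (fun q => ∑ p ∈ (free g).erase q.2, xhat x q.1 • psiC (addTwo g r q.2 true p) b)).symm
    rw [h1, sum_offDiag_swap (free g) (fun a c => ∑ p ∈ (free g).erase c, xhat x a • psiC (addTwo g r c true p) b),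
      sum_offDiag_eq_sum_erase, sum_offDiag_eq_sum_erase]
    refine Finset.sum_congr rfl fun j _ => ?_
    dsimp only
    rw [Finset.sum_comm]
    refine Finset.sum_congr rfl fun p _ => ?_
    rw [Finset.sum_smul]

/-- The query on the state. [cite: AmbainisIraidsSmotrovs2013, §4] -/
theorem queryOracle_mulVec_live (x : Fin (2 * k + 1) → Bool) (n : ℕ) :
    queryOracle x *ᵥ live x n = ∑ g ∈ validSet k n, beta x n g • phiX x g := by
  rw [live, mulVec_sum]
  refine Finset.sum_congr rfl fun g _ => ?_
  rw [mulVec_smul, queryOracle_mulVec_phiC]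

/-- **One round**: `U_r O_x (live_r) = live_{r+1}`. [cite: AmbainisIraidsSmotrovs2013, §4 (proof of Thm. 2)] -/
theorem roundGate_query_live (x : Fin (2 * k + 1) → Bool) (r : Fin k) :
    (roundGate r : Matrix (S k) (S k) ℂ) *ᵥ (queryOracle x *ᵥ live x r.val) = live x (r.val + 1) := by
  rw [queryOracle_mulVec_live, mulVec_sum]
  -- the summand family for the re-indexing
  set Φ : Bool → Hist k → Bool → Fin (2 * k + 1) × Fin (2 * k + 1) → (S k → ℂ) := fun b g' bi q =>
    (beta x r.val (eraseRound g' r) * (tgt b : ℂ) * cN (k - r.val) * childAmp x (eraseRound g' r) r bi q) •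
      psiC g' b with hΦ
  -- per parent `g`: the round gate produces the `Φ`-terms of its children
  have hterm : ∀ g ∈ validSet k r.val, (roundGate r : Matrix (S k) (S k) ℂ) *ᵥ (beta x r.val g • phiX x g) =
      ∑ b : Bool, ∑ bi : Bool, ∑ q ∈ (free g).offDiag, Φ b (addTwo g r q.1 bi q.2) bi q := by
    intro g hg
    have hv := mem_validSet.1 hg
    rw [mulVec_smul, phiX, mulVec_sum, Finset.smul_sum]
    refine Finset.sum_congr rfl fun b _ => ?_
    rw [mulVec_smul, roundGate_mulVec_psiX x r hv b, cw_eq_cN hv (le_of_lt r.isLt), Fintype.sum_bool]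
    simp only [hΦ, smul_add, Finset.smul_sum, smul_smul]
    rw [add_comm]
    congr 1
    · refine Finset.sum_congr rfl fun q hq => ?_
      obtain ⟨hq1, hq2, hne⟩ := Finset.mem_offDiag.1 hq
      rw [eraseRound_addTwo hv (r := r) le_rfl true (mem_free.1 hq1) (mem_free.1 hq2)]
      simp only [childAmp, if_true]
      congr 1; ring
    · refine Finset.sum_congr rfl fun q hq => ?_
      obtain ⟨hq1, hq2, hne⟩ := Finset.mem_offDiag.1 hq
      rw [eraseRound_addTwo hv (r := r) le_rfl false (mem_free.1 hq1) (mem_free.1 hq2)]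
      simp only [childAmp, Bool.false_eq_true, if_false]
      congr 1; ring
  rw [Finset.sum_congr rfl hterm, Finset.sum_comm]
  -- the target `live_{r+1}` as a `(b, g')` double sum
  have hlive : live x (r.val + 1) = ∑ b : Bool, ∑ g' ∈ validSet k (r.val + 1),
      (beta x (r.val + 1) g' * (tgt b : ℂ)) • psiC g' b := by
    rw [live]
    have hg : ∀ g' ∈ validSet k (r.val + 1), beta x (r.val + 1) g' • phiC g' =
        ∑ b : Bool, (beta x (r.val + 1) g' * (tgt b : ℂ)) • psiC g' b := fun g' _ => by
      rw [phiC, Finset.smul_sum]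
      exact Finset.sum_congr rfl fun b _ => by rw [smul_smul]
    rw [Finset.sum_congr rfl hg, Finset.sum_comm]
  rw [hlive]
  refine Finset.sum_congr rfl fun b _ => ?_
  rw [sum_validSet_reindex r.isLt (Φ b)]
  refine Finset.sum_congr rfl fun g' _ => ?_
  -- fold the `q`-sum into `roundAmp`
  have hq : ∀ q ∈ (labelSet g' ⟨r.val, r.isLt⟩).offDiag,
      (if g' q.2 = some (⟨r.val, r.isLt⟩, false) then Φ b g' (decide (g' q.1 = some (⟨r.val, r.isLt⟩, true))) q else 0) =
        (beta x r.val (eraseRound g' r) * (tgt b : ℂ) * cN (k - r.val) *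
          (if g' q.2 = some (r, false) then childAmp x (eraseRound g' r) r (decide (g' q.1 = some (r, true))) q else 0)) •
          psiC g' b := by
    intro q _
    have hr : (⟨r.val, r.isLt⟩ : Fin k) = r := Fin.ext rfl
    rw [hr]
    split_ifs with hc
    · rfl
    · simp
  have hr : (⟨r.val, r.isLt⟩ : Fin k) = r := Fin.ext rfl
  rw [Finset.sum_congr rfl hq, ← Finset.sum_smul, ← Finset.mul_sum]
  congr 1
  rw [beta_succ, hr, roundAmp]
  ring

/-! ### The invariant -/

/-- **The state after `n ≤ k` rounds is `live_n`.** [cite: AmbainisIraidsSmotrovs2013, §4 (proof of Thm. 2)] -/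
theorem runTok_rounds (x : Fin (2 * k + 1) → Bool) :
    ∀ n, n ≤ k → runTok x (QTok.gate (G0 k) :: rounds k n) (Pi.single (startS k) 1) = live x n
  | 0, _ => by rw [rounds, runTok_cons, runTok_nil, QTok.mat, G0_mulVec_start, c0_eq_phiC, live_zero]
  | n + 1, hn => by
    have hnk : n < k := by omega
    rw [rounds, ← List.cons_append, runTok_append, runTok_rounds x n (by omega)]
    simp only [runTok_cons, runTok_nil, QTok.mat, roundGateN, dif_pos hnk]
    exact roundGate_query_live x ⟨n, hnk⟩

/-! ### Exactness -/

/-- The final state: rotate, then the classical query writes `x_l` of the last free `l` into the target.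
[cite: AmbainisIraidsSmotrovs2013, §4 (base case)] -/
theorem finalState_apply (x : Fin (2 * k + 1) → Bool) (s : S k) :
    runTok x (majProg k) (Pi.single (startS k) 1) s =
      ∑ g ∈ validSet k k, beta x k g * psiC g false (s.1, (s.2.1 ^^ x s.1), s.2.2) := by
  rw [majProg, ← List.cons_append, runTok_append, runTok_rounds x k le_rfl]
  simp only [runTok_cons, runTok_nil, QTok.mat]
  rw [queryOracle_mulVec_apply, live, mulVec_sum, Finset.sum_apply]
  refine Finset.sum_congr rfl fun g _ => ?_
  rw [mulVec_smul, rotGate_mulVec_phiC, Pi.smul_apply, smul_eq_mul]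

/-- On a full valid history the rotated slice state is the basis state `|l, 0, g⟩` of the last free `l`.
[cite: AmbainisIraidsSmotrovs2013, §4] -/
theorem final_term (x : Fin (2 * k + 1) → Bool) {g : Hist k} (hv : Valid k g) (s : S k) :
    psiC g false (s.1, (s.2.1 ^^ x s.1), s.2.2) = if s.2.1 = x s.1 ∧ s.2.2 = g ∧ g s.1 = none then 1 else 0 := by
  rw [psiC_apply_of_full hv]
  have : ((s.2.1 ^^ x s.1) = false) ↔ s.2.1 = x s.1 := by
    cases s.2.1 <;> cases x s.1 <;> simp
  simp only [this]

/-- **The program computes `MAJ_{2k+1}` exactly**: acceptance probability `[ k + 1 ≤ |x| ]`.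
[cite: AmbainisIraidsSmotrovs2013, Thm. 2] -/
theorem majAlg_acceptProb (x : Fin (2 * k + 1) → Bool) :
    (majAlg k).acceptProb x = if k + 1 ≤ Grover.hw x then 1 else 0 := by
  classical
  -- the final state, and where it can be non-zero
  have hfin := finalState_apply x
  have hsupp : ∀ s : S k, runTok x (majProg k) (Pi.single (startS k) 1) s ≠ 0 →
      s.2.1 = x s.1 ∧ (x s.1 = true ↔ k + 1 ≤ Grover.hw x) := by
    intro s hs
    rw [hfin] at hs
    obtain ⟨g, hg, hgs⟩ := Finset.exists_ne_zero_of_sum_ne_zero hs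
    have hv := mem_validSet.1 hg
    rw [final_term x hv] at hgs
    by_cases hc : s.2.1 = x s.1 ∧ s.2.2 = g ∧ g s.1 = none
    · have hb : beta x k g ≠ 0 := by intro h0; apply hgs; rw [h0, zero_mul]
      exact ⟨hc.1, eq_maj_of_beta_ne_zero hv hb (mem_free.2 hc.2.2)⟩
    · exact absurd (by rw [if_neg hc, mul_zero]) hgs
  -- total mass one
  have hnorm : ∑ s, ‖runTok x (majProg k) (Pi.single (startS k) 1) s‖ ^ 2 = 1 := by
    rw [sum_norm_sq_runTok, Finset.sum_eq_single (startS k)]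
    · simp
    · intro s _ hs; rw [Pi.single_eq_of_ne hs]; simp
    · intro h1; exact absurd (Finset.mem_univ _) h1
  rw [majAlg, toAlg_acceptProb]
  unfold wt
  by_cases hx : k + 1 ≤ Grover.hw x
  · rw [if_pos hx, ← hnorm]
    refine Finset.sum_filter_of_ne fun s _ hs => ?_
    have hs' : runTok x (majProg k) (Pi.single (startS k) 1) s ≠ 0 := by
      intro h0; apply hs; rw [h0]; simp
    obtain ⟨h1, h2⟩ := hsupp s hs'
    show s.2.1 = true
    rw [h1]; exact h2.2 hx
  · rw [if_neg hx]
    refine Finset.sum_eq_zero fun s hs => ?_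
    rw [Finset.mem_filter] at hs
    by_cases h0 : runTok x (majProg k) (Pi.single (startS k) 1) s = 0
    · rw [h0]; simp
    · obtain ⟨h1, h2⟩ := hsupp s h0
      have : s.2.1 = true := hs.2
      exact absurd (h2.1 (h1 ▸ this)) hx

/-- The program computes `MAJ_{2k+1}` with error `0` on every input. [cite: AmbainisIraidsSmotrovs2013, Thm. 2] -/
theorem majAlg_computesWithError :
    (majAlg k).ComputesWithError 0 Set.univ fun x => decide (k + 1 ≤ Grover.hw x) := by
  intro x _
  rw [majAlg_acceptProb]
  constructor
  · intro h
    rw [decide_eq_true_eq] at h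
    rw [if_pos h]; norm_num
  · intro h
    have h' : ¬ k + 1 ≤ Grover.hw x := by simpa using h
    rw [if_neg h']

/-! ### Theorem 2 -/

/-- **Ceiling [AIS13, Thm. 2]: `Q_ε(MAJ_{2k+1}) ≤ k + 1`** for every `0 ≤ ε` (the `(k+1)`-query exact algorithm).
[cite: AmbainisIraidsSmotrovs2013, Thm. 2] -/
theorem quantumQueryComplexity_maj_le {ε : ℝ} (hε : 0 ≤ ε) :
    quantumQueryComplexity ε (fun x : Fin (2 * k + 1) → Bool => decide (k + 1 ≤ Grover.hw x)) ≤ k + 1 := by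
  change quantumQueryComplexityOn ε Set.univ _ ≤ _
  calc quantumQueryComplexityOn ε Set.univ (fun x : Fin (2 * k + 1) → Bool => decide (k + 1 ≤ Grover.hw x))
      ≤ (majAlg k).queries :=
        Nat.sInf_le ⟨majAlg k, rfl, majAlg_computesWithError.mono hε (Set.subset_univ _)⟩
    _ = k + 1 := majAlg_queries

/-- **Ambainis–Iraids–Smotrovs, Thm. 2 with Prop. 3: `Q_E(MAJ_{2k+1}) = k + 1`** — the floor
`max{k+1, (2k+1) − (k+1) + 1} ≤ Q_E` is `ExactThreshold.le_quantumQueryComplexity_zero_threshold` (typed, Q11).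
[cite: AmbainisIraidsSmotrovs2013, Thm. 2] -/
theorem quantumQueryComplexity_zero_maj :
    quantumQueryComplexity 0 (fun x : Fin (2 * k + 1) → Bool => decide (k + 1 ≤ Grover.hw x)) = k + 1 :=
  le_antisymm (quantumQueryComplexity_maj_le le_rfl) (by
    have h := le_quantumQueryComplexity_zero_threshold (N := 2 * k + 1) (t := k + 1) (by omega) (by omega)
    rwa [show 2 * k + 1 - (k + 1) + 1 = k + 1 by omega, max_self] at h)

/-! ### Checks -/

/-- `k = 0`: one query reads the single variable (`MAJ_1(x) = x_0`). [cite: AmbainisIraidsSmotrovs2013, Thm. 2] -/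
example : quantumQueryComplexity 0 (fun x : Fin (2 * 0 + 1) → Bool => decide (0 + 1 ≤ Grover.hw x)) = 0 + 1 :=
  quantumQueryComplexity_zero_maj

/-- `k = 1`: `Q_E(MAJ_3) = 2` (classically `D(MAJ_3) = 3`). [cite: AmbainisIraidsSmotrovs2013, Thm. 2] -/
example : quantumQueryComplexity 0 (fun x : Fin (2 * 1 + 1) → Bool => decide (1 + 1 ≤ Grover.hw x)) = 1 + 1 :=
  quantumQueryComplexity_zero_maj

/-- The program makes exactly `k + 1` queries (here `k = 2`: `MAJ_5` with `3` queries). [cite: AmbainisIraidsSmotrovs2013, Thm. 2] -/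
example : numQueries (majProg 2) = 3 := numQueries_majProg

/-- Exactness: the acceptance probability is `{0,1}`-valued at every input. [cite: AmbainisIraidsSmotrovs2013, Thm. 2] -/
example (x : Fin (2 * k + 1) → Bool) : (majAlg k).acceptProb x = 0 ∨ (majAlg k).acceptProb x = 1 := by
  rw [majAlg_acceptProb]; split_ifs <;> simp

end Literature.Computability.QuantumComplexity.Majority

end
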